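import Literature.Analysis.SpecialFunctions.GammaStirlingVertical
import Literature.Analysis.SpecialFunctions.GammaVerticalBounds
import Literature.Analysis.SpecialFunctions.GammaStirlingOrder
import HarnessLib

/-!
# The ratio `Γ(w + u)/Γ(w)` on vertical lines, uniformly for `1/4 ≤ Re w ≤ 3/4` and ALL `Im w`

Topic `Literature/NumberTheory/LFunctions`, support file for the smooth approximate functional
equation of Dirichlet `L`-functions (the kernel `V_s(y) = (1/2πi)∫ Γ((s+u+𝔞)/2)/Γ((s+𝔞)/2) · G(u) y^{-u} du/u`,
`𝔞 ∈ {0,1}` the parity, so `w = (s+𝔞)/2` has `Re w ∈ {1/4, 3/4}` on the critical line `Re s = ½`).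
Everything here is PROVED; no definitions, no named facts. It is the companion of the tree's
`ConreyIwaniec2002GammaShiftRatio.lean` (`AFEKernel.exists_norm_Gamma_add_div_le`: the strip
`3/8 ≤ Re w ≤ 5/8`, `|Im w| ≥ 1/2`, shifts `−1/4 ≤ Re u ≤ 6`), proved along the same lines
(two-sided vertical Stirling `GammaStirling.exists_norm_Gamma_vertical_le/ge` when
`|Im w|, |Im(w+u)| ≥ 1`; `‖Γ(x+iy)‖ ≤ Γ(x)` and `‖Γ(x+iy)‖ ≥ (2/15)e^{−π|y|/2}` in the compact
remainder), for the range needed by the Dirichlet gamma factor: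

* `exists_norm_Gamma_add_div_le` — there is an absolute `C` with
  `‖Γ(w+u)/Γ(w)‖ ≤ C ‖w‖^{Re u} (1 + |Im u|)^7 e^{π|Im u|/2}`
  for `1/4 ≤ Re w ≤ 3/4`, ALL `Im w`, `−1/8 ≤ Re u ≤ 3`
  (coordinate form `exists_norm_Gamma_add_le_coord`).

This is the uniform Stirling input "`γ(f, s+u)/γ(f, s) ≪ 𝔮_∞(s)^{Re u/2} exp(…|u|)`" of the proof of
the approximate functional equation / convexity bound [IwaniecKowalski2004, Proposition 5.4 and
(5.20)], in the degree-one case.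

## References
* [IwaniecKowalski2004] H. Iwaniec, E. Kowalski, *Analytic Number Theory*, AMS Colloquium Publ. 53
  (2004), §5.2, Theorem 5.3, Proposition 5.4.
* [ConreyIwaniec2002] B. Conrey, H. Iwaniec, Acta Arith. 103 (2002), Lemma 7.2 (proof).
-/

noncomputable section

open Complex Real Set

namespace Literature.NumberTheory.LFunctions

namespace DirichletConvexity

open Literature.Analysis.SpecialFunctions

/-- `Γ(x) ≤ 720` for `1/8 ≤ x ≤ 7` (convexity of `Γ`, `Γ(1/8) = 8Γ(9/8) ≤ 8`, `Γ(7) = 720`).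
[folklore] -/
private theorem Real_Gamma_le {x : ℝ} (h1 : 1 / 8 ≤ x) (h2 : x ≤ 7) : Real.Gamma x ≤ 720 := by
  have hconv := Real.convexOn_Gamma
  have h98 : Real.Gamma (1 / 8 + 1) ≤ 1 := by
    have h := ConvexOn.le_max_of_mem_Icc hconv (show (1 : ℝ) ∈ Ioi 0 by norm_num)
      (show (2 : ℝ) ∈ Ioi 0 by norm_num) (show (1 / 8 + 1 : ℝ) ∈ Icc 1 2 by norm_num)
    rwa [Real.Gamma_one, Real.Gamma_two, max_self] at h
  have h18 : Real.Gamma (1 / 8) ≤ 8 := by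
    have hrec : Real.Gamma (1 / 8 + 1) = 1 / 8 * Real.Gamma (1 / 8) :=
      Real.Gamma_add_one (by norm_num)
    linarith
  have h7 : Real.Gamma 7 = 720 := by
    have h := Real.Gamma_nat_eq_factorial 6
    have e : ((6 : ℕ) : ℝ) + 1 = 7 := by norm_num
    rw [e] at h
    rw [h]
    norm_num [Nat.factorial]
  have h := ConvexOn.le_max_of_mem_Icc hconv (show (1 / 8 : ℝ) ∈ Ioi 0 by norm_num)
    (show (7 : ℝ) ∈ Ioi 0 by norm_num) ⟨h1, h2⟩
  exact h.trans (max_le (by linarith) h7.le)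

/-- `|τ + v|^e ≤ |τ|^e (1+|v|)^7` for `|τ| ≥ 1`, `|τ+v| ≥ 1`, `|e| ≤ 7`. [folklore] -/
private theorem abs_add_rpow_le {τ v e : ℝ} (hτ : 1 ≤ |τ|) (hs : 1 ≤ |τ + v|) (he1 : -7 ≤ e)
    (he2 : e ≤ 7) : |τ + v| ^ e ≤ |τ| ^ e * (1 + |v|) ^ 7 := by
  have hv0 : 0 ≤ |v| := abs_nonneg v
  have h1v : 1 ≤ 1 + |v| := by linarith
  have hτ0 : 0 < |τ| := by linarith
  have hP : ∀ f : ℝ, f ≤ 7 → (1 + |v|) ^ f ≤ (1 + |v|) ^ 7 := by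
    intro f hf
    calc (1 + |v|) ^ f ≤ (1 + |v|) ^ (7 : ℝ) := Real.rpow_le_rpow_of_exponent_le h1v hf
      _ = (1 + |v|) ^ 7 := by norm_cast
  have hτe : 0 ≤ |τ| ^ e := Real.rpow_nonneg hτ0.le e
  rcases le_or_gt 0 e with he | he
  · -- `|τ+v| ≤ |τ|(1+|v|)`
    have hle : |τ + v| ≤ |τ| * (1 + |v|) := by
      have h1 : |τ + v| ≤ |τ| + |v| := abs_add_le τ v
      nlinarith
    calc |τ + v| ^ e ≤ (|τ| * (1 + |v|)) ^ e := Real.rpow_le_rpow (abs_nonneg _) hle he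
      _ = |τ| ^ e * (1 + |v|) ^ e := Real.mul_rpow hτ0.le (by linarith)
      _ ≤ |τ| ^ e * (1 + |v|) ^ 7 := mul_le_mul_of_nonneg_left (hP e he2) hτe
  · -- `|τ| ≤ |τ+v|(1+|v|)`
    have hle : |τ| / (1 + |v|) ≤ |τ + v| := by
      rw [div_le_iff₀ (by linarith)]
      have h1 : |τ| ≤ |τ + v| + |v| := by
        have h := abs_sub_abs_le_abs_sub τ (τ + v)
        rw [show τ - (τ + v) = -v by ring, abs_neg] at h
        linarith
      nlinarith
    have hpos : 0 < |τ| / (1 + |v|) := by positivity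
    calc |τ + v| ^ e ≤ (|τ| / (1 + |v|)) ^ e := Real.rpow_le_rpow_of_nonpos hpos hle he.le
      _ = |τ| ^ e / (1 + |v|) ^ e := Real.div_rpow hτ0.le (by linarith) e
      _ = |τ| ^ e * (1 + |v|) ^ (-e) := by
          rw [Real.rpow_neg (by linarith), div_eq_mul_inv]
      _ ≤ |τ| ^ e * (1 + |v|) ^ 7 := mul_le_mul_of_nonneg_left (hP (-e) (by linarith)) hτe

/-- Arithmetic of Case I (both Stirling bounds). [folklore] -/
private theorem caseI_arith {C₁ c₂ N D A X T P E Y wc τc : ℝ} (hc₂ : 0 < c₂) (hC₁ : 0 ≤ C₁)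
    (hN : N ≤ C₁ * A * X) (hA : A ≤ τc * T * P) (hτc : τc ≤ 2 * wc) (hX : X ≤ E * Y)
    (hD : c₂ * T * Y ≤ D) (hT : 0 ≤ T) (hP : 0 ≤ P) (hE : 0 ≤ E) (hX0 : 0 ≤ X)
    (hwc : 0 ≤ wc) : N ≤ 2 * C₁ / c₂ * wc * P * E * D := by
  have h1 : C₁ * A * X ≤ C₁ * (2 * wc * T * P) * (E * Y) := by
    apply mul_le_mul _ hX hX0 (by positivity)
    exact mul_le_mul_of_nonneg_left (hA.trans (by gcongr)) hC₁
  have h2 : C₁ * (2 * wc * T * P) * (E * Y) = 2 * C₁ / c₂ * wc * P * E * (c₂ * T * Y) := by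
    rw [show 2 * C₁ / c₂ * wc * P * E * (c₂ * T * Y) = (2 * C₁ / c₂ * c₂) * (wc * P * E * T * Y)
      by ring, div_mul_cancel₀ _ hc₂.ne']
    ring
  have h3 : 2 * C₁ / c₂ * wc * P * E * (c₂ * T * Y) ≤ 2 * C₁ / c₂ * wc * P * E * D :=
    mul_le_mul_of_nonneg_left hD (by positivity)
  linarith

/-- Arithmetic of Case II (`|Im(w+u)| < 1 ≤ |Im w|`). [folklore] -/
private theorem caseII_arith {c₂ N D T P E Y wc p K : ℝ} (hc₂ : 0 < c₂) (hK : 0 < K)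
    (hN : N ≤ 720) (h1 : 1 ≤ p * T) (h2 : 1 ≤ 2 * p * wc) (h3 : 1 ≤ K * E * Y) (h4 : p * p ≤ P)
    (hD : c₂ * T * Y ≤ D) (hT : 0 ≤ T) (hE : 0 ≤ E) (hY : 0 ≤ Y) (hwc : 0 ≤ wc) (hp : 0 ≤ p) :
    N ≤ 2 * 720 * K / c₂ * wc * P * E * D := by
  have hP0 : 0 ≤ P := le_trans (mul_nonneg hp hp) h4
  have hN0 : N ≤ 720 * 1 * 1 * 1 := by linarith
  have s1 : (720 : ℝ) * 1 * 1 * 1 ≤ 720 * (p * T) * (2 * p * wc) * (K * E * Y) := by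
    gcongr
  have s2 : 720 * (p * T) * (2 * p * wc) * (K * E * Y) = 1440 * K * wc * T * E * Y * (p * p) := by
    ring
  have s3 : 1440 * K * wc * T * E * Y * (p * p) ≤ 1440 * K * wc * T * E * Y * P :=
    mul_le_mul_of_nonneg_left h4 (by positivity)
  have s4 : 1440 * K * wc * T * E * Y * P = 2 * 720 * K / c₂ * wc * P * E * (c₂ * T * Y) := by
    rw [show 2 * 720 * K / c₂ * wc * P * E * (c₂ * T * Y) =
      (2 * 720 * K / c₂ * c₂) * (wc * P * E * T * Y) by ring, div_mul_cancel₀ _ hc₂.ne']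
    ring
  have s5 : 2 * 720 * K / c₂ * wc * P * E * (c₂ * T * Y) ≤ 2 * 720 * K / c₂ * wc * P * E * D :=
    mul_le_mul_of_nonneg_left hD (by positivity)
  linarith

/-- Arithmetic of Case III (`|Im w| < 1`). [folklore] -/
private theorem caseIII_arith {C₁ m₀ N D P E wc : ℝ} (hm₀ : 0 < m₀) (hC₁ : 0 ≤ C₁)
    (hN : N ≤ (C₁ + 720) * P) (hwc : 1 / 64 ≤ wc) (hE : 1 ≤ E) (hD : m₀ ≤ D) (hP : 0 ≤ P) :
    N ≤ 64 * (C₁ + 720) / m₀ * wc * P * E * D := by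
  have hwc0 : 0 ≤ wc := by linarith
  have hD0 : 0 ≤ D := by linarith
  have hDm : 1 ≤ D / m₀ := by rw [le_div_iff₀ hm₀]; linarith
  have h64 : (1 : ℝ) ≤ 64 * wc := by linarith
  have s1 : (C₁ + 720) * P * 1 * 1 * 1 ≤ (C₁ + 720) * P * (64 * wc) * E * (D / m₀) := by
    gcongr
  have s2 : (C₁ + 720) * P * (64 * wc) * E * (D / m₀) = 64 * (C₁ + 720) / m₀ * wc * P * E * D := by
    field_simp
  linarith

/-- `‖Γ(σ + iτ)‖ ≥ (2/15) e^{−π/2} (4/7)` for `1/4 ≤ σ ≤ 3/4`, `|τ| < 1`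
(`Γ(w) = Γ(w+1)/w` and the tree's `‖Γ(x+iy)‖ ≥ (2/15)e^{−π|y|/2}` on `1/2 ≤ x ≤ 5/2`). [folklore] -/
private theorem norm_Gamma_ge_of_abs_im_lt_one {σ τ : ℝ} (hσ1 : 1 / 4 ≤ σ) (hσ2 : σ ≤ 3 / 4)
    (hτ1 : |τ| < 1) :
    2 / 15 * Real.exp (-(π * 1) / 2) * (4 / 7) ≤ ‖Complex.Gamma ((σ : ℂ) + τ * I)‖ := by
  have hσ_le : σ ≤ ‖(σ : ℂ) + τ * I‖ := by
    have := Complex.abs_re_le_norm ((σ : ℂ) + τ * I)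
    simpa [abs_of_pos (show (0:ℝ) < σ by linarith)] using this
  have hw_le : ‖(σ : ℂ) + τ * I‖ ≤ 3 / 4 + |τ| := by
    have h1 := Complex.norm_le_abs_re_add_abs_im ((σ : ℂ) + τ * I)
    have h2 : |σ| = σ := abs_of_pos (by linarith)
    simp only [add_re, ofReal_re, mul_re, I_re, mul_zero, ofReal_im, I_im, mul_one, sub_self,
      add_zero, add_im, mul_im, zero_add] at h1
    rw [h2] at h1
    linarith
  have hw_pos : 0 < ‖(σ : ℂ) + τ * I‖ := by linarith
  have hw0 : (σ : ℂ) + τ * I ≠ 0 := norm_pos_iff.1 hw_pos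
  have hrec := Complex.Gamma_add_one _ hw0
  have e : (σ : ℂ) + τ * I + 1 = ((σ + 1 : ℝ) : ℂ) + (τ : ℂ) * I := by push_cast; ring
  have h1 : 2 / 15 * Real.exp (-(π * |τ|) / 2) ≤ ‖Complex.Gamma (((σ + 1 : ℝ) : ℂ) + (τ : ℂ) * I)‖ :=
    norm_Gamma_ge_exp (by linarith) (by linarith) τ
  rw [← e, hrec, norm_mul] at h1
  have h2 : Real.exp (-(π * 1) / 2) ≤ Real.exp (-(π * |τ|) / 2) :=
    Real.exp_le_exp.2 (by nlinarith [Real.pi_pos])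
  have h3 : ‖(σ : ℂ) + τ * I‖ ≤ 7 / 4 := by linarith
  have h4 : ‖(σ : ℂ) + τ * I‖ * ‖Complex.Gamma ((σ : ℂ) + τ * I)‖ ≤
      7 / 4 * ‖Complex.Gamma ((σ : ℂ) + τ * I)‖ :=
    mul_le_mul_of_nonneg_right h3 (norm_nonneg _)
  linarith

/-- **Coordinate form of the ratio bound**: an absolute `C` with
`‖Γ(σ+c + i(τ+v))‖ ≤ C ‖σ+iτ‖^c (1+|v|)^7 e^{π|v|/2} ‖Γ(σ+iτ)‖` for `1/4 ≤ σ ≤ 3/4`, all real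
`τ`, `−1/8 ≤ c ≤ 3`, all real `v` (uniform Stirling for the quotient of gamma factors).
[cite: IwaniecKowalski2004, Proposition 5.4 (proof)] -/
theorem exists_norm_Gamma_add_le_coord :
    ∃ C : ℝ, 0 < C ∧ ∀ (σ τ c v : ℝ), 1 / 4 ≤ σ → σ ≤ 3 / 4 →
      -1 / 8 ≤ c → c ≤ 3 →
        ‖Complex.Gamma (((σ + c : ℝ) : ℂ) + ((τ + v : ℝ) : ℂ) * I)‖ ≤
          C * ‖(σ : ℂ) + τ * I‖ ^ c * (1 + |v|) ^ 7 * Real.exp (π * |v| / 2) *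
            ‖Complex.Gamma ((σ : ℂ) + τ * I)‖ := by
  obtain ⟨C₁, hC₁, hup⟩ := GammaStirling.exists_norm_Gamma_vertical_le (1 / 8) 7
  obtain ⟨c₂, hc₂, hlo⟩ := GammaStirling.exists_norm_Gamma_vertical_ge (1 / 4) (3 / 4)
  have hm₀pos : 0 < 2 / 15 * Real.exp (-(π * 1) / 2) * (4 / 7) := by positivity
  have hKpos : 0 < Real.exp (π / 2) := Real.exp_pos _
  refine ⟨2 * C₁ / c₂ + 2 * 720 * Real.exp (π / 2) / c₂ +
      64 * (C₁ + 720) / (2 / 15 * Real.exp (-(π * 1) / 2) * (4 / 7)), by positivity,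
    fun σ τ c v hσ1 hσ2 hc1 hc2 ↦ ?_⟩
  have hCa : 0 ≤ 2 * C₁ / c₂ := by positivity
  have hCb : 0 ≤ 2 * 720 * Real.exp (π / 2) / c₂ := by positivity
  have hCc : 0 ≤ 64 * (C₁ + 720) / (2 / 15 * Real.exp (-(π * 1) / 2) * (4 / 7)) := by
    positivity
  have hv0 : 0 ≤ |v| := abs_nonneg v
  have h1v : 1 ≤ 1 + |v| := by linarith
  -- norms of `w = σ + iτ`
  have hD : 0 < ‖Complex.Gamma ((σ : ℂ) + τ * I)‖ :=
    norm_pos_iff.2 (GammaVert.Gamma_ne_zero_of_pos (by linarith) τ)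
  have hτ_le : |τ| ≤ ‖(σ : ℂ) + τ * I‖ := by
    have := Complex.abs_im_le_norm ((σ : ℂ) + τ * I)
    simpa using this
  have hσ_le : σ ≤ ‖(σ : ℂ) + τ * I‖ := by
    have := Complex.abs_re_le_norm ((σ : ℂ) + τ * I)
    simpa [abs_of_pos (show (0:ℝ) < σ by linarith)] using this
  have hw_le : ‖(σ : ℂ) + τ * I‖ ≤ 3 / 4 + |τ| := by
    have h1 := Complex.norm_le_abs_re_add_abs_im ((σ : ℂ) + τ * I)
    have h2 : |σ| = σ := abs_of_pos (by linarith)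
    simp only [add_re, ofReal_re, mul_re, I_re, mul_zero, ofReal_im, I_im, mul_one, sub_self,
      add_zero, add_im, mul_im, zero_add] at h1
    rw [h2] at h1
    linarith
  have hw_pos : 0 < ‖(σ : ℂ) + τ * I‖ := by linarith
  have hE1 : 1 ≤ Real.exp (π * |v| / 2) := Real.one_le_exp (by positivity)
  have hP1 : (1 : ℝ) ≤ (1 + |v|) ^ 7 := one_le_pow₀ h1v
  -- it suffices to prove the bound with any of the three partial constants
  have hX0 : 0 ≤ ‖(σ : ℂ) + τ * I‖ ^ c * (1 + |v|) ^ 7 * Real.exp (π * |v| / 2) *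
      ‖Complex.Gamma ((σ : ℂ) + τ * I)‖ := by positivity
  have finish : ∀ C' : ℝ,
      C' ≤ 2 * C₁ / c₂ + 2 * 720 * Real.exp (π / 2) / c₂ +
        64 * (C₁ + 720) / (2 / 15 * Real.exp (-(π * 1) / 2) * (4 / 7)) →
      ‖Complex.Gamma (((σ + c : ℝ) : ℂ) + ((τ + v : ℝ) : ℂ) * I)‖ ≤
        C' * ‖(σ : ℂ) + τ * I‖ ^ c * (1 + |v|) ^ 7 * Real.exp (π * |v| / 2) *
          ‖Complex.Gamma ((σ : ℂ) + τ * I)‖ →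
      ‖Complex.Gamma (((σ + c : ℝ) : ℂ) + ((τ + v : ℝ) : ℂ) * I)‖ ≤
        (2 * C₁ / c₂ + 2 * 720 * Real.exp (π / 2) / c₂ +
          64 * (C₁ + 720) / (2 / 15 * Real.exp (-(π * 1) / 2) * (4 / 7))) *
          ‖(σ : ℂ) + τ * I‖ ^ c * (1 + |v|) ^ 7 * Real.exp (π * |v| / 2) *
          ‖Complex.Gamma ((σ : ℂ) + τ * I)‖ := by
    intro C' hC' h
    refine h.trans ?_
    have h1 := mul_le_mul_of_nonneg_right hC' hX0
    calc C' * ‖(σ : ℂ) + τ * I‖ ^ c * (1 + |v|) ^ 7 * Real.exp (π * |v| / 2) *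
          ‖Complex.Gamma ((σ : ℂ) + τ * I)‖
        = C' * (‖(σ : ℂ) + τ * I‖ ^ c * (1 + |v|) ^ 7 * Real.exp (π * |v| / 2) *
          ‖Complex.Gamma ((σ : ℂ) + τ * I)‖) := by ring
      _ ≤ _ := h1
      _ = _ := by ring
  -- `N ≤ 720` always
  have hN720 : ‖Complex.Gamma (((σ + c : ℝ) : ℂ) + ((τ + v : ℝ) : ℂ) * I)‖ ≤ 720 :=
    (GammaVert.norm_Gamma_le_Gamma_re (by linarith) _).trans
      (Real_Gamma_le (by linarith) (by linarith))
  rcases le_or_gt 1 |τ| with hτ1 | hτ1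
  · -- `|τ| ≥ 1`: sharp lower bound for the denominator
    have hDlo := hlo σ ⟨hσ1, hσ2⟩ τ hτ1
    have hτ0 : 0 < |τ| := by linarith
    have hT0 : 0 ≤ |τ| ^ (σ - 1 / 2) := Real.rpow_nonneg hτ0.le _
    rcases le_or_gt 1 |τ + v| with hs1 | hs1
    · -- Case I: both Stirling bounds
      have hNup := hup (σ + c) ⟨by linarith, by linarith⟩ (τ + v) hs1
      have h1 : |τ + v| ^ (σ + c - 1 / 2) ≤ |τ| ^ c * |τ| ^ (σ - 1 / 2) * (1 + |v|) ^ 7 := by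
        have h := abs_add_rpow_le hτ1 hs1 (e := σ + c - 1 / 2) (by linarith) (by linarith)
        have e : |τ| ^ (σ + c - 1 / 2) = |τ| ^ c * |τ| ^ (σ - 1 / 2) := by
          rw [← Real.rpow_add hτ0]; ring_nf
        rwa [e] at h
      -- `|τ|^c ≤ 2 ‖w‖^c`
      have h3 : |τ| ^ c ≤ 2 * ‖(σ : ℂ) + τ * I‖ ^ c := by
        rcases le_or_gt 0 c with hc | hc
        · have := Real.rpow_le_rpow hτ0.le hτ_le hc
          linarith [Real.rpow_nonneg hw_pos.le c]
        · have hle : ‖(σ : ℂ) + τ * I‖ / 2 ≤ |τ| := by linarith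
          calc |τ| ^ c ≤ (‖(σ : ℂ) + τ * I‖ / 2) ^ c :=
                Real.rpow_le_rpow_of_nonpos (by positivity) hle hc.le
            _ = ‖(σ : ℂ) + τ * I‖ ^ c * (2 : ℝ) ^ (-c) := by
                rw [Real.div_rpow hw_pos.le (by norm_num), Real.rpow_neg (by norm_num),
                  div_eq_mul_inv]
            _ ≤ ‖(σ : ℂ) + τ * I‖ ^ c * (2 : ℝ) ^ (1 : ℝ) :=
                mul_le_mul_of_nonneg_left
                  (Real.rpow_le_rpow_of_exponent_le (by norm_num) (by linarith))
                  (Real.rpow_nonneg hw_pos.le c)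
            _ = 2 * ‖(σ : ℂ) + τ * I‖ ^ c := by rw [Real.rpow_one]; ring
      -- the exponentials: `e^{-π|τ+v|/2} ≤ E e^{-π|τ|/2}`
      have h4 : Real.exp (-(π * |τ + v|) / 2) ≤
          Real.exp (π * |v| / 2) * Real.exp (-(π * |τ|) / 2) := by
        rw [← Real.exp_add]
        apply Real.exp_le_exp.2
        have h5 : |τ| - |τ + v| ≤ |v| := by
          have h := abs_sub_abs_le_abs_sub τ (τ + v)
          rwa [show τ - (τ + v) = -v by ring, abs_neg] at h
        have h6 := mul_le_mul_of_nonneg_left h5 Real.pi_pos.le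
        linarith only [h6]
      refine finish (2 * C₁ / c₂) (by linarith only [hCb, hCc]) ?_
      exact caseI_arith hc₂ hC₁.le hNup h1 h3 h4 hDlo hT0 (by positivity) (by positivity)
        (by positivity) (Real.rpow_nonneg hw_pos.le c)
    · -- Case II: `|τ + v| < 1`, so `|τ| ≤ 1 + |v|`; numerator `≤ 720`
      have hτv : |τ| ≤ 1 + |v| := by
        have h := abs_sub_abs_le_abs_sub τ (τ + v)
        rw [show τ - (τ + v) = -v by ring, abs_neg] at h
        linarith
      have h1 : 1 ≤ (1 + |v|) * |τ| ^ (σ - 1 / 2) := by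
        have ha : |τ| ^ (-1 : ℝ) ≤ |τ| ^ (σ - 1 / 2) :=
          Real.rpow_le_rpow_of_exponent_le hτ1 (by linarith)
        rw [Real.rpow_neg_one] at ha
        have hc' : 1 ≤ (1 + |v|) * |τ|⁻¹ := by
          rw [le_mul_inv_iff₀ hτ0]; linarith
        exact hc'.trans (mul_le_mul_of_nonneg_left ha (by linarith))
      have h2 : 1 ≤ 2 * (1 + |v|) * ‖(σ : ℂ) + τ * I‖ ^ c := by
        rcases le_or_gt 0 c with hc | hc
        · have h1' : 1 ≤ ‖(σ : ℂ) + τ * I‖ ^ c := Real.one_le_rpow (by linarith) hc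
          have h2' : (1 : ℝ) ≤ 2 * (1 + |v|) := by linarith
          calc (1 : ℝ) = 1 * 1 := by ring
            _ ≤ 2 * (1 + |v|) * ‖(σ : ℂ) + τ * I‖ ^ c :=
                mul_le_mul h2' h1' (by norm_num) (by positivity)
        · have hge1 : 1 ≤ ‖(σ : ℂ) + τ * I‖ := by linarith
          have ha : ‖(σ : ℂ) + τ * I‖ ^ (-1 : ℝ) ≤ ‖(σ : ℂ) + τ * I‖ ^ c :=
            Real.rpow_le_rpow_of_exponent_le hge1 (by linarith)
          rw [Real.rpow_neg_one] at ha
          have hb : 1 ≤ 2 * (1 + |v|) * ‖(σ : ℂ) + τ * I‖⁻¹ := by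
            rw [le_mul_inv_iff₀ hw_pos]; linarith
          exact hb.trans (mul_le_mul_of_nonneg_left ha (by positivity))
      have h3 : 1 ≤ Real.exp (π / 2) * Real.exp (π * |v| / 2) * Real.exp (-(π * |τ|) / 2) := by
        rw [← Real.exp_add, ← Real.exp_add]
        apply Real.one_le_exp
        have h6 := mul_le_mul_of_nonneg_left hτv Real.pi_pos.le
        linarith only [h6]
      have h4 : (1 + |v|) * (1 + |v|) ≤ (1 + |v|) ^ 7 := by
        have h5 : (1 : ℝ) ≤ (1 + |v|) ^ 5 := one_le_pow₀ h1v
        calc (1 + |v|) * (1 + |v|) = (1 + |v|) * (1 + |v|) * 1 := by ring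
          _ ≤ (1 + |v|) * (1 + |v|) * (1 + |v|) ^ 5 :=
              mul_le_mul_of_nonneg_left h5 (by positivity)
          _ = (1 + |v|) ^ 7 := by ring
      refine finish (2 * 720 * Real.exp (π / 2) / c₂) (by linarith only [hCa, hCc]) ?_
      exact caseII_arith hc₂ hKpos hN720 h1 h2 h3 h4 hDlo hT0 (by positivity) (by positivity)
        (Real.rpow_nonneg hw_pos.le c) (by linarith)
  · -- Case III: `|τ| < 1`: everything is compact in `w`
    have hDlo : 2 / 15 * Real.exp (-(π * 1) / 2) * (4 / 7) ≤ ‖Complex.Gamma ((σ : ℂ) + τ * I)‖ :=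
      norm_Gamma_ge_of_abs_im_lt_one hσ1 hσ2 hτ1
    -- numerator `≤ (C₁ + 720) P`
    have hNup : ‖Complex.Gamma (((σ + c : ℝ) : ℂ) + ((τ + v : ℝ) : ℂ) * I)‖ ≤
        (C₁ + 720) * (1 + |v|) ^ 7 := by
      have hP0 : (0 : ℝ) ≤ (1 + |v|) ^ 7 := by positivity
      rcases le_or_gt 1 |τ + v| with hs1 | hs1
      · have h1 := hup (σ + c) ⟨by linarith, by linarith⟩ (τ + v) hs1
        have h2 : |τ + v| ^ (σ + c - 1 / 2) ≤ (1 + |v|) ^ 7 := by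
          rcases le_or_gt 0 (σ + c - 1 / 2) with he | he
          · have hle : |τ + v| ≤ 1 + |v| := by
              have := abs_add_le τ v; linarith
            calc |τ + v| ^ (σ + c - 1 / 2) ≤ (1 + |v|) ^ (σ + c - 1 / 2) :=
                  Real.rpow_le_rpow (abs_nonneg _) hle he
              _ ≤ (1 + |v|) ^ (7 : ℝ) := Real.rpow_le_rpow_of_exponent_le h1v (by linarith)
              _ = (1 + |v|) ^ 7 := by norm_cast
          · exact (Real.rpow_le_one_of_one_le_of_nonpos hs1 he.le).trans hP1
        have h3 : Real.exp (-(π * |τ + v|) / 2) ≤ 1 := by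
          apply Real.exp_le_one_iff.2
          have h6 := mul_nonneg Real.pi_pos.le (abs_nonneg (τ + v))
          linarith only [h6]
        calc ‖Complex.Gamma (((σ + c : ℝ) : ℂ) + ((τ + v : ℝ) : ℂ) * I)‖
            ≤ C₁ * |τ + v| ^ (σ + c - 1 / 2) * Real.exp (-(π * |τ + v|) / 2) := h1
          _ ≤ C₁ * (1 + |v|) ^ 7 * 1 :=
              mul_le_mul (mul_le_mul_of_nonneg_left h2 hC₁.le) h3 (Real.exp_pos _).le
                (by positivity)
          _ ≤ (C₁ + 720) * (1 + |v|) ^ 7 := by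
              rw [mul_one]; exact mul_le_mul_of_nonneg_right (by linarith) hP0
      · calc ‖Complex.Gamma (((σ + c : ℝ) : ℂ) + ((τ + v : ℝ) : ℂ) * I)‖ ≤ 720 * 1 := by
              rw [mul_one]; exact hN720
          _ ≤ (C₁ + 720) * (1 + |v|) ^ 7 := mul_le_mul (by linarith) hP1 (by norm_num) (by positivity)
    -- `‖w‖^c ≥ 1/64`
    have hwc : 1 / 64 ≤ ‖(σ : ℂ) + τ * I‖ ^ c := by
      rcases le_or_gt 0 c with hc | hc
      · calc (1 / 64 : ℝ) = (1 / 4) ^ (3 : ℝ) := by norm_num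
          _ ≤ (1 / 4 : ℝ) ^ c :=
              Real.rpow_le_rpow_of_exponent_ge (by norm_num) (by norm_num) hc2
          _ ≤ ‖(σ : ℂ) + τ * I‖ ^ c := Real.rpow_le_rpow (by norm_num) (by linarith) hc
      · calc (1 / 64 : ℝ) ≤ (2 : ℝ) ^ (-1 : ℝ) := by
              rw [Real.rpow_neg_one]; norm_num
          _ ≤ (2 : ℝ) ^ c := Real.rpow_le_rpow_of_exponent_le (by norm_num) (by linarith)
          _ ≤ ‖(σ : ℂ) + τ * I‖ ^ c := Real.rpow_le_rpow_of_nonpos hw_pos (by linarith) hc.le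
    refine finish (64 * (C₁ + 720) / (2 / 15 * Real.exp (-(π * 1) / 2) * (4 / 7)))
      (by linarith only [hCa, hCb]) ?_
    exact caseIII_arith hm₀pos hC₁.le hNup hwc hE1 hDlo (by positivity)

/-- **`Γ(w+u)/Γ(w) ≪ ‖w‖^{Re u} (1+|Im u|)^7 e^{π|Im u|/2}`** uniformly for `1/4 ≤ Re w ≤ 3/4`,
all `Im w`, `−1/8 ≤ Re u ≤ 3` (Stirling's formula for the quotient of gamma factors
`γ(s+u)/γ(s)`, up to a factor exponential in `|u|` which the test function `G` absorbs).
[cite: IwaniecKowalski2004, Proposition 5.4 (proof)] -/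
theorem exists_norm_Gamma_add_div_le :
    ∃ C : ℝ, 0 < C ∧ ∀ (w u : ℂ), 1 / 4 ≤ w.re → w.re ≤ 3 / 4 →
      -1 / 8 ≤ u.re → u.re ≤ 3 →
        ‖Complex.Gamma (w + u) / Complex.Gamma w‖ ≤
          C * ‖w‖ ^ u.re * (1 + |u.im|) ^ 7 * Real.exp (π * |u.im| / 2) := by
  obtain ⟨C, hC, h⟩ := exists_norm_Gamma_add_le_coord
  refine ⟨C, hC, fun w u hσ1 hσ2 hc1 hc2 ↦ ?_⟩
  have hw : (w.re : ℂ) + w.im * I = w := re_add_im w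
  have hwu : ((w.re + u.re : ℝ) : ℂ) + ((w.im + u.im : ℝ) : ℂ) * I = w + u := by
    apply Complex.ext <;> simp
  have key := h w.re w.im u.re u.im hσ1 hσ2 hc1 hc2
  rw [hw, hwu] at key
  have hD : 0 < ‖Complex.Gamma w‖ := by
    have := GammaVert.Gamma_ne_zero_of_pos (x := w.re) (by linarith) w.im
    rw [hw] at this
    exact norm_pos_iff.2 this
  rw [norm_div, div_le_iff₀ hD]
  exact key

end DirichletConvexity

end Literature.NumberTheory.LFunctions

end
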